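import Summits.ResolutionOfSingularities.ResolutionOfSingularities.Theorems.FrobeniusLadderFRationalResolutionClassOneThird112Charts
import Summits.ResolutionOfSingularities.ResolutionOfSingularities.Theorems.FrobeniusLadderFRationalResolutionClassZModWeights
import HarnessLib

/-!
# Crux `FrobeniusLadder.FRationalResolution` (stmt-ResolutionOfSingularities-15317), line `redirect`,
# stub `stub_diagonalizableQuotientResolution` — THE FIRST THREEFOLD CLASS THROUGH THE PIPELINE: `1/3(1,1,2)`

The weight kernel `P = {m ∈ ℕ³ : 3 ∣ m₀ + m₁ + 2 m₂}` (the cyclic quotient threefold singularity `1/3(1,1,2)`, wild in characteristic `3`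
as `𝔸³/μ₃`; not of Veronese / same-degree type): Hilbert basis `G = {(3,0,0),(0,3,0),(0,0,3),(1,0,1),(0,1,1),(2,1,0),(1,2,0)}` (box check),
Newton vertices the first five, exponent identities `3g = v + q₁ + q₂`, and all five vertex charts free (`…ClassOneThird112Charts`) — so
ONE point blow-up resolves.

* ★★★★ `hasResolution_of_isolated_fixedPoints_oneThird112`, ★★★★ `hasResolution_of_isolated_fixedPoints_zmod3_112` (`A = ℤ/3`, `a = (1,1,2)`).

Honest label: a TOY instance (one threefold class, one blow-up) of the class pipeline; no stub, crux or summit closed. No definitions,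
no named facts, no sorry. [folklore; cite: CoxLittleSchenck2011, §11.4] [cite: Kato1994, Thm. (3.2)]
-/

noncomputable section

-- single-problem summit: the doubled namespace component is forced
set_option linter.dupNamespace false

open CategoryTheory AlgebraicGeometry TopologicalSpace IsLocalRing
open Literature.AlgebraicGeometry.Resolution

namespace Summit.ResolutionOfSingularities.ResolutionOfSingularities.Theorems.FRationalResolution.ClassOneThird112

open ConeCertificateGenerators

/-- The exponent of `p ∈ ℕⁿ` in `ℤⁿ`. -/
local notation3 (prettyPrint := false) "toZ[" n "]" =>
  (Finsupp.mapRange.addMonoidHom (Nat.castAddMonoidHom ℤ) : (Fin n →₀ ℕ) →+ (Fin n →₀ ℤ))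

/-- The Hilbert basis of `1/3(1,1,2)`. -/
local notation3 (prettyPrint := false) "G7" => ({Finsupp.single 0 3, Finsupp.single 1 3, Finsupp.single 2 3, Finsupp.single 0 1 + Finsupp.single 2 1, Finsupp.single 1 1 + Finsupp.single 2 1, Finsupp.single 0 2 + Finsupp.single 1 1, Finsupp.single 0 1 + Finsupp.single 1 2} : Set (Fin 3 →₀ ℕ))

/-- `Σ mᵢ • aᵢ` on `Fin 3`. [folklore] -/
theorem weight_fin_three {A : Type} [AddCommMonoid A] (a : Fin 3 → A) (m : Fin 3 →₀ ℕ) :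
    Finsupp.weight a m = m 0 • a 0 + m 1 • a 1 + m 2 • a 2 := by
  rw [WeightKernelBasis.weight_eq_sum, Fin.sum_univ_three]

/-- The weight kernel of `a = (1, 1, 2)` in `ℤ/3`. [folklore] -/
theorem weight_zmod3_112_eq_zero_iff (a : Fin 3 → ZMod 3) (h0 : a 0 = 1) (h1 : a 1 = 1) (h2 : a 2 = ((2 : ℕ) : ZMod 3))
    (m : Fin 3 →₀ ℕ) : Finsupp.weight a m = 0 ↔ 3 ∣ m 0 + m 1 + 2 * m 2 := by
  rw [weight_fin_three, h0, h1, h2, ← ZMod.natCast_eq_zero_iff]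
  simp only [nsmul_eq_mul, mul_one, Nat.cast_add, Nat.cast_mul]
  constructor <;> intro h <;> simpa [mul_comm] using h

/-- ★★★★ **RESOLUTION OF VARIETIES WHOSE SINGULAR POINTS ARE ISOLATED FIXED POINTS OF TYPE `1/3(1,1,2)`** (threefold, any
characteristic): the point blow-up resolves. [folklore; cite: CoxLittleSchenck2011, §11.4] [cite: Kato1994, Thm. (3.2)] -/
theorem hasResolution_of_isolated_fixedPoints_oneThird112 (k : Type) [Field k] (X : Scheme.{0}) [IsIntegral X]
    (f : X ⟶ Spec (.of k)) [LocallyOfFiniteType f] (hfin : (Scheme.regularLocus X)ᶜ.Finite)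
    (hchart : ∀ t : X, t ∉ Scheme.regularLocus X →
      ∃ (k' : Type) (_ : Field k') (A : Type) (_ : DecidableEq A) (_ : AddCommGroup A) (_ : AddMonoid.IsTorsion A)
        (S : Type) (_ : CommRing S) (_ : Algebra k' S) (𝒮 : A → Submodule k' S) (_ : GradedAlgebra 𝒮)
        (_ : Algebra.FiniteType k' S) (φ : Spec (.of (𝒮 0)) ⟶ X) (_ : Etale φ)
        (𝔔 : Ideal S) (_ : 𝔔.IsPrime) (_ : ∀ a : A, a ≠ 0 → ∀ s ∈ 𝒮 a, s ∈ 𝔔)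
        (x : Fin 3 → S) (a : Fin 3 → A) (P : AddSubmonoid (Fin 3 →₀ ℕ))
        (_ : ∀ i, x i ∈ 𝔔 ∧ x i ∈ 𝒮 (a i))
        (_ : Ideal.span (algebraMap S (Localization.AtPrime 𝔔) '' Set.range x) = maximalIdeal (Localization.AtPrime 𝔔))
        (_ : ((3 : ℕ) : WithBot ℕ∞) = ringKrullDim (Localization.AtPrime 𝔔))
        (_ : ∀ m, m ∈ P ↔ Finsupp.weight a m = 0)
        (_ : ∀ m : Fin 3 →₀ ℕ, m ∈ P ↔ 3 ∣ m 0 + m 1 + 2 * m 2),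
        φ ⟨𝔔.comap (algebraMap (𝒮 0) S), inferInstance⟩ = t) :
    Scheme.HasResolution X := by
  refine MonoidAlgebraLaurent.hasResolution_of_isolated_fixedPoints_of_mixedConeCertificate k X f hfin fun t ht => ?_
  have hc := hchart t ht
  obtain ⟨k', ik, A, iA₁, iA₂, hA, S, iS₁, iS₂, 𝒮, i𝒮, iS₃, φ, iφ, 𝔔, i𝔔, hfix, x, a, P, hxa, hspan, hn, hP, hcls, hφt⟩ := hc
  -- ### the Hilbert basis
  have hgP0 : (Finsupp.single 0 3 : Fin 3 →₀ ℕ) ∈ P := (hcls _).2 (by simp)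
  have hgP1 : (Finsupp.single 1 3 : Fin 3 →₀ ℕ) ∈ P := (hcls _).2 (by simp)
  have hgP2 : (Finsupp.single 2 3 : Fin 3 →₀ ℕ) ∈ P := (hcls _).2 (by simp)
  have hgP3 : (Finsupp.single 0 1 + Finsupp.single 2 1 : Fin 3 →₀ ℕ) ∈ P := (hcls _).2 (by simp)
  have hgP4 : (Finsupp.single 1 1 + Finsupp.single 2 1 : Fin 3 →₀ ℕ) ∈ P := (hcls _).2 (by simp)
  have hgP5 : (Finsupp.single 0 2 + Finsupp.single 1 1 : Fin 3 →₀ ℕ) ∈ P := (hcls _).2 (by simp)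
  have hgP6 : (Finsupp.single 0 1 + Finsupp.single 1 2 : Fin 3 →₀ ℕ) ∈ P := (hcls _).2 (by simp)
  have hGfin : (G7).Finite := ((((((Set.finite_singleton _).insert _).insert _).insert _).insert _).insert _).insert _
  have hGP' : G7 ⊆ P := by
    rintro g (rfl | rfl | rfl | rfl | rfl | rfl | rfl)
    exacts [hgP0, hgP1, hgP2, hgP3, hgP4, hgP5, hgP6]
  have hG0 : (0 : Fin 3 →₀ ℕ) ∉ G7 := by
    rintro (h | h | h | h | h | h | h)
    · have := DFunLike.congr_fun h 0; simp at this
    · have := DFunLike.congr_fun h 1; simp at this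
    · have := DFunLike.congr_fun h 2; simp at this
    · have := DFunLike.congr_fun h 0; simp at this
    · have := DFunLike.congr_fun h 1; simp at this
    · have := DFunLike.congr_fun h 0; simp at this
    · have := DFunLike.congr_fun h 0; simp at this
  have hGP : AddSubmonoid.closure G7 = P := by
    refine WeightKernelBasis.closure_eq_of_box P G7 hGP' ?_ 3 (by norm_num) ?_ ?_
    · intro m hm g hg hgm
      have hm' := (hcls m).1 hm
      have hg' := (hcls g).1 hg
      have h0 := Finsupp.le_def.1 hgm 0
      have h1 := Finsupp.le_def.1 hgm 1
      have h2 := Finsupp.le_def.1 hgm 2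
      refine (hcls _).2 ?_
      simp only [Finsupp.tsub_apply]
      omega
    · intro i
      fin_cases i
      · exact Or.inl rfl
      · exact Or.inr (Or.inl rfl)
      · exact Or.inr (Or.inr (Or.inl rfl))
    · intro m hm hm0 hlt
      have hm' := (hcls m).1 hm
      have h0 := hlt 0
      have h1 := hlt 1
      have h2 := hlt 2
      have hne : m 0 ≠ 0 ∨ m 1 ≠ 0 ∨ m 2 ≠ 0 := by
        by_contra h
        push Not at h
        exact hm0 (by ext i; fin_cases i <;> simp [h.1, h.2.1, h.2.2])
      by_cases hd : 1 ≤ m 0 ∧ 1 ≤ m 2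
      · refine ⟨Finsupp.single 0 1 + Finsupp.single 2 1, Or.inr (Or.inr (Or.inr (Or.inl rfl))), ?_, ?_⟩
        · intro h; have := DFunLike.congr_fun h 0; simp at this
        · refine Finsupp.le_def.2 fun i => ?_
          fin_cases i <;> simp <;> omega
      by_cases he : 1 ≤ m 1 ∧ 1 ≤ m 2
      · refine ⟨Finsupp.single 1 1 + Finsupp.single 2 1, Or.inr (Or.inr (Or.inr (Or.inr (Or.inl rfl)))), ?_, ?_⟩
        · intro h; have := DFunLike.congr_fun h 1; simp at this
        · refine Finsupp.le_def.2 fun i => ?_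
          fin_cases i <;> simp <;> omega
      by_cases hf : 2 ≤ m 0 ∧ 1 ≤ m 1
      · refine ⟨Finsupp.single 0 2 + Finsupp.single 1 1, Or.inr (Or.inr (Or.inr (Or.inr (Or.inr (Or.inl rfl))))), ?_, ?_⟩
        · intro h; have := DFunLike.congr_fun h 0; simp at this
        · refine Finsupp.le_def.2 fun i => ?_
          fin_cases i <;> simp <;> omega
      refine ⟨Finsupp.single 0 1 + Finsupp.single 1 2, Or.inr (Or.inr (Or.inr (Or.inr (Or.inr (Or.inr rfl))))), ?_, ?_⟩
      · intro h; have := DFunLike.congr_fun h 0; simp at this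
      · refine Finsupp.le_def.2 fun i => ?_
        fin_cases i <;> simp <;> omega
  -- ### the enumeration of `G`
  obtain ⟨gen, hgen0, hgen1, hgen2, hgen3, hgen4, hgen5, hgen6⟩ : ∃ gen : Fin 7 → ↥P, ((gen 0 : ↥P) : Fin 3 →₀ ℕ) = (Finsupp.single 0 3 : Fin 3 →₀ ℕ) ∧ ((gen 1 : ↥P) : Fin 3 →₀ ℕ) = (Finsupp.single 1 3 : Fin 3 →₀ ℕ) ∧ ((gen 2 : ↥P) : Fin 3 →₀ ℕ) = (Finsupp.single 2 3 : Fin 3 →₀ ℕ) ∧ ((gen 3 : ↥P) : Fin 3 →₀ ℕ) = (Finsupp.single 0 1 + Finsupp.single 2 1 : Fin 3 →₀ ℕ) ∧ ((gen 4 : ↥P) : Fin 3 →₀ ℕ) = (Finsupp.single 1 1 + Finsupp.single 2 1 : Fin 3 →₀ ℕ) ∧ ((gen 5 : ↥P) : Fin 3 →₀ ℕ) = (Finsupp.single 0 2 + Finsupp.single 1 1 : Fin 3 →₀ ℕ) ∧ ((gen 6 : ↥P) : Fin 3 →₀ ℕ) = (Finsupp.single 0 1 + Finsupp.single 1 2 :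 Fin 3 →₀ ℕ) :=
    ⟨![⟨(Finsupp.single 0 3 : Fin 3 →₀ ℕ), hgP0⟩, ⟨(Finsupp.single 1 3 : Fin 3 →₀ ℕ), hgP1⟩, ⟨(Finsupp.single 2 3 : Fin 3 →₀ ℕ), hgP2⟩, ⟨(Finsupp.single 0 1 + Finsupp.single 2 1 : Fin 3 →₀ ℕ), hgP3⟩, ⟨(Finsupp.single 1 1 + Finsupp.single 2 1 : Fin 3 →₀ ℕ), hgP4⟩, ⟨(Finsupp.single 0 2 + Finsupp.single 1 1 : Fin 3 →₀ ℕ), hgP5⟩, ⟨(Finsupp.single 0 1 + Finsupp.single 1 2 : Fin 3 →₀ ℕ), hgP6⟩], rfl, rfl, rfl, rfl, rfl, rfl, rfl⟩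
  have hgenG : ∀ i, ((gen i : ↥P) : Fin 3 →₀ ℕ) ∈ G7 := by
    intro i
    fin_cases i
    · exact Or.inl hgen0
    · exact Or.inr (Or.inl hgen1)
    · exact Or.inr (Or.inr (Or.inl hgen2))
    · exact Or.inr (Or.inr (Or.inr (Or.inl hgen3)))
    · exact Or.inr (Or.inr (Or.inr (Or.inr (Or.inl hgen4))))
    · exact Or.inr (Or.inr (Or.inr (Or.inr (Or.inr (Or.inl hgen5)))))
    · exact Or.inr (Or.inr (Or.inr (Or.inr (Or.inr (Or.inr hgen6)))))
  have hGgen : ∀ g ∈ G7, ∃ i, ((gen i : ↥P) : Fin 3 →₀ ℕ) = g := by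
    rintro g (rfl | rfl | rfl | rfl | rfl | rfl | rfl)
    exacts [⟨0, hgen0⟩, ⟨1, hgen1⟩, ⟨2, hgen2⟩, ⟨3, hgen3⟩, ⟨4, hgen4⟩, ⟨5, hgen5⟩, ⟨6, hgen6⟩]
  have hgen0' : ∀ j, gen j ≠ 0 := by
    intro j h
    have h' : ((gen j : ↥P) : Fin 3 →₀ ℕ) = 0 := by rw [h]; rfl
    exact hG0 (h' ▸ hgenG j)
  -- ### the exponent identities `3 g = v + q₁ + q₂`
  have hid : ∀ i : Fin 7, (2 + 1) • gen i =
      (![gen 0, gen 1, gen 2, gen 3, gen 4] : Fin 5 → ↥P) ((![0, 1, 2, 3, 4, 0, 1] : Fin 7 → Fin 5) i) + ∑ l : Fin 2,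
      (![![gen 0, gen 0], ![gen 1, gen 1], ![gen 2, gen 2], ![gen 3, gen 3], ![gen 4, gen 4], ![gen 0, gen 1], ![gen 0, gen 1]] :
        Fin 7 → Fin 2 → ↥P) i l := by
    intro i
    fin_cases i <;> apply Subtype.ext <;>
      simp [Fin.sum_univ_two, AddSubmonoidClass.coe_nsmul, AddSubmonoid.coe_add, hgen0, hgen1, hgen2, hgen3, hgen4, hgen5, hgen6] <;>
      ext kk <;> fin_cases kk <;> simp
  refine ⟨k', ik, A, iA₁, iA₂, hA, S, iS₁, iS₂, 𝒮, i𝒮, iS₃, φ, iφ, 𝔔, i𝔔, hfix, 3, x, a, P, hxa, hspan, hn, hP, G7, hGfin, hG0, hGP,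
    hφt, 7, gen, hgenG, hGgen, 5, ![gen 0, gen 1, gen 2, gen 3, gen 4], fun j => by fin_cases j <;> exact hgen0' _, 3, by norm_num,
    ![0, 1, 2, 3, 4, 0, 1], fun _ => 2, fun _ => le_rfl,
    ![![gen 0, gen 0], ![gen 1, gen 1], ![gen 2, gen 2], ![gen 3, gen 3], ![gen 4, gen 4], ![gen 0, gen 1], ![gen 0, gen 1]],
    fun i l => by fin_cases i <;> fin_cases l <;> exact hgen0' _, hid, fun j => ?_⟩
  -- ### the five free vertex charts
  fin_cases j
  · exact chart_a P hGP gen hgen0 hgen1 hgen2 hgen3 hgen4 hgen5 hgen6 hgen0'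
  · exact chart_b P hGP gen hgen0 hgen1 hgen2 hgen3 hgen4 hgen5 hgen6 hgen0'
  · exact chart_c P hGP gen hgen0 hgen1 hgen2 hgen3 hgen4 hgen5 hgen6 hgen0'
  · exact chart_d P hGP gen hgen0 hgen1 hgen2 hgen3 hgen4 hgen5 hgen6 hgen0'
  · exact chart_e P hGP gen hgen0 hgen1 hgen2 hgen3 hgen4 hgen5 hgen6 hgen0'

/-- ★★★★ **`A = ℤ/3`, weights `(1,1,2)`**: the same with the single honest hypothesis. [folklore; cite: CoxLittleSchenck2011, §11.4] -/
theorem hasResolution_of_isolated_fixedPoints_zmod3_112 (k : Type) [Field k] (X : Scheme.{0}) [IsIntegral X]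
    (f : X ⟶ Spec (.of k)) [LocallyOfFiniteType f] (hfin : (Scheme.regularLocus X)ᶜ.Finite)
    (hchart : ∀ t : X, t ∉ Scheme.regularLocus X →
      ∃ (k' : Type) (_ : Field k')
        (S : Type) (_ : CommRing S) (_ : Algebra k' S) (𝒮 : ZMod 3 → Submodule k' S) (_ : GradedAlgebra 𝒮)
        (_ : Algebra.FiniteType k' S) (φ : Spec (.of (𝒮 0)) ⟶ X) (_ : Etale φ)
        (𝔔 : Ideal S) (_ : 𝔔.IsPrime) (_ : ∀ a : ZMod 3, a ≠ 0 → ∀ s ∈ 𝒮 a, s ∈ 𝔔)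
        (x : Fin 3 → S) (P : AddSubmonoid (Fin 3 →₀ ℕ))
        (_ : ∀ i, x i ∈ 𝔔 ∧ x i ∈ 𝒮 (![(1 : ZMod 3), 1, ((2 : ℕ) : ZMod 3)] i))
        (_ : Ideal.span (algebraMap S (Localization.AtPrime 𝔔) '' Set.range x) = maximalIdeal (Localization.AtPrime 𝔔))
        (_ : ((3 : ℕ) : WithBot ℕ∞) = ringKrullDim (Localization.AtPrime 𝔔))
        (_ : ∀ m, m ∈ P ↔ Finsupp.weight (![(1 : ZMod 3), 1, ((2 : ℕ) : ZMod 3)]) m = 0),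
        φ ⟨𝔔.comap (algebraMap (𝒮 0) S), inferInstance⟩ = t) :
    Scheme.HasResolution X := by
  refine hasResolution_of_isolated_fixedPoints_oneThird112 k X f hfin fun t ht => ?_
  have hc := hchart t ht
  obtain ⟨k', ik, S, iS₁, iS₂, 𝒮, i𝒮, iS₃, φ, iφ, 𝔔, i𝔔, hfix, x, P, hxa, hspan, hn, hP, hφt⟩ := hc
  haveI : Fact (1 < 3) := ⟨by norm_num⟩
  exact ⟨k', ik, ZMod 3, inferInstance, inferInstance, is_add_torsion_of_finite (G := ZMod 3), S, iS₁, iS₂, 𝒮, i𝒮, iS₃, φ, iφ,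
    𝔔, i𝔔, hfix, x, ![(1 : ZMod 3), 1, ((2 : ℕ) : ZMod 3)], P, hxa, hspan, hn, hP,
    fun m => (hP m).trans (weight_zmod3_112_eq_zero_iff _ rfl rfl rfl m), hφt⟩

end Summit.ResolutionOfSingularities.ResolutionOfSingularities.Theorems.FRationalResolution.ClassOneThird112

end
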